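import Literature.NumberTheory.DiophantineApproximation.RhinViolaPolynomialCaseIntegrality
import Literature.NumberTheory.DiophantineApproximation.RhinViolaDoubleResidue
import HarnessLib

/-!
# Rhin–Viola 2005, Lemma 2.2 (the polynomial case), with the degree bound, for all three integrals

Topic `Literature/NumberTheory/DiophantineApproximation`. Everything here is PROVED (no definitions, no named
facts). Source: G. Rhin, C. Viola, *The permutation group method for the dilogarithm*, Ann. Sc. Norm. Super.
Pisa Cl. Sci. (5) 4 (2005) 389–437, Lemma 2.2 (pp. 395–396): if `min{l+m−j, j+k−m} < 0` then Theorem 2.1 holds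
with `Q = R = 0`. For `j + k < m` the integrand is a polynomial `S(x,y,z) ∈ ℤ[x,y,z]` with
`deg_x S = m+h−k−1`, `deg_y S = l+m−j−1`, `deg_z S = m−j−k−1`, so that `I^{(1)} = I^{(2)} = 0` and
`d_{m+h−k} d_{l+m−j} z^{l+m} I_z = T(z) ∈ ℤ[z]`, `deg T ≤ m−j−k−1`; the case `l + m < j` follows by `λ`.

`RhinViolaPolynomialCaseIntegrality.lean` proves the existence of `T` for `I^{(0)}` (without the degree bound);
this file adds the degree bound `deg T ≤ m−j−k−1` (from `deg_z S`), and records the vanishing of `I^{(1)}`,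
`I^{(2)}` in BOTH cases `j+k < m` and `l+m < j` directly from the residue forms (in the second case the Hasse
derivative `D^{(j+k−m)}` kills `Y^k(1−Y)^l`, of degree `k+l < j+k−m`), so that the `λ`-step of the paper is
needed only for `I^{(0)}` (`I0_lam`).

## References

* G. Rhin, C. Viola, Ann. Sc. Norm. Super. Pisa Cl. Sci. (5) 4 (2005) 389–437, Lemma 2.2. [RhinViola2005]
-/

noncomputable section

namespace Literature.NumberTheory.DiophantineApproximation

namespace RhinViola

open _root_.MeasureTheory _root_.Set Finset Polynomial
open ViolaZudilin (unitSquare denom₁ measurableSet_unitSquare)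

/-! ### `I^{(1)} = I^{(2)} = 0` in both polynomial cases -/

/-- If `l + m < j` the inner residue vanishes (`deg(Y^k(1−Y)^l) = k + l < j + k − m`).
[cite: RhinViola2005, Lemma 2.2] -/
theorem innerRes_of_lt' {z : ℝ} {j k l m : ℕ} (hj : l + m < j) (x : ℝ) : innerRes z j k l m x = 0 := by
  rw [innerRes]
  split_ifs with hm
  · rw [hasseDeriv_eq_zero_of_lt_natDegree, eval_zero, zero_div]
    refine lt_of_le_of_lt natDegree_mul_le ?_
    have h1 : ((X : ℝ[X]) ^ k).natDegree ≤ k := (natDegree_X_pow k).le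
    have h2 : ((1 - X : ℝ[X]) ^ l).natDegree ≤ l := by
      have := natDegree_pow_le_of_le l
        (show (1 - X : ℝ[X]).natDegree ≤ 1 from (natDegree_sub_le _ _).trans (by simp))
      simpa using this
    omega
  · rfl

/-- `I_z^{(1)}(h,j,k,l,m) = 0` if `l + m < j`. [cite: RhinViola2005, Lemma 2.2] -/
theorem I1_of_lt' {z : ℝ} (h : ℕ) {j k l m : ℕ} (hj : l + m < j) : I1 z h j k l m = 0 := by
  simp [I1, innerRes_of_lt' hj]

/-- `I_z^{(2)}(h,j,k,l,m) = 0` if `l + m < j`. [cite: RhinViola2005, Lemma 2.2] -/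
theorem I2_of_lt' {z : ℝ} (h : ℕ) {j k l m : ℕ} (hj : l + m < j) : I2 z h j k l m = 0 := by
  rw [I2]
  split_ifs with hm
  · have hP : hasseDeriv (j + k - m) ((X : ℝ[X]) ^ k * (1 - X) ^ l) = 0 := by
      refine hasseDeriv_eq_zero_of_lt_natDegree _ _ (lt_of_le_of_lt natDegree_mul_le ?_)
      have h1 : ((X : ℝ[X]) ^ k).natDegree ≤ k := (natDegree_X_pow k).le
      have h2 : ((1 - X : ℝ[X]) ^ l).natDegree ≤ l := by
        have := natDegree_pow_le_of_le l
          (show (1 - X : ℝ[X]).natDegree ≤ 1 from (natDegree_sub_le _ _).trans (by simp))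
        simpa using this
      omega
    simp [hP]
  · rfl

/-- `I_z(h,j,k,l,m) = I_z^{(0)}(h,j,k,l,m)` in both polynomial cases. [cite: RhinViola2005, Lemma 2.2] -/
theorem I_eq_I0_of_lt {z : ℝ} (h : ℕ) {j k l m : ℕ} (hjm : j + k < m ∨ l + m < j) : I z h j k l m = I0 z h j k l m := by
  rcases hjm with h1 | h1
  · rw [I, I1_of_lt h h1, mul_zero, sub_zero]
  · rw [I, I1_of_lt' h h1, mul_zero, sub_zero]

/-! ### The degree bound for `T` -/

/-- `d_A d_B ∫∫ f(x,y,z) dx dy = T(z)`, `T ∈ ℤ[z]`, **with `deg T ≤ deg_z f`**. [cite: RhinViola2005, Lemma 2.2 (proof)] -/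
theorem exists_poly_eq_lcm_mul_setIntegral_aeval' (f : MvPolynomial (Fin 3) ℤ) {A B : ℕ}
    (hA : f.degreeOf 0 < A) (hB : f.degreeOf 1 < B) :
    ∃ T : Polynomial ℤ, T.natDegree ≤ f.degreeOf 2 ∧ ∀ z : ℝ, (Polynomial.aeval z T : ℝ) =
      (Nat.lcmUpto A : ℝ) * Nat.lcmUpto B * ∫ p in unitSquare, MvPolynomial.aeval ![p.1, p.2, z] f := by
  obtain ⟨T, hT⟩ := exists_poly_eq_lcm_mul_setIntegral_aeval f hA hB
  -- the explicit `T` of that proof; we rebuild it to read off the degree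
  set T' : Polynomial ℤ := ∑ d ∈ f.support, Polynomial.C (MvPolynomial.coeff d f * ((Nat.lcmUpto A : ℤ) /
    (d 0 + 1)) * ((Nat.lcmUpto B : ℤ) / (d 1 + 1))) * Polynomial.X ^ (d 2) with hT'
  have hdeg : T'.natDegree ≤ f.degreeOf 2 := by
    refine natDegree_sum_le_of_forall_le _ _ fun d hd => ?_
    refine (natDegree_C_mul_le _ _).trans ((natDegree_X_pow _).le.trans ?_)
    exact MvPolynomial.monomial_le_degreeOf 2 hd
  have hval : ∀ z : ℝ, (Polynomial.aeval z T' : ℝ) =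
      (Nat.lcmUpto A : ℝ) * Nat.lcmUpto B * ∫ p in unitSquare, MvPolynomial.aeval ![p.1, p.2, z] f := by
    intro z
    -- the integral, monomialwise
    have hint : ∫ p in unitSquare, MvPolynomial.aeval ![p.1, p.2, z] f =
        ∑ d ∈ f.support, ((MvPolynomial.coeff d f : ℤ) : ℝ) * z ^ d 2 / (((d 0 : ℝ) + 1) * ((d 1 : ℝ) + 1)) := by
      simp only [aeval_eq_sum_coeff, Matrix.cons_val_zero, Matrix.cons_val_one, Matrix.cons_val]
      rw [integral_finsetSum _ fun d _ => ?_]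
      · refine sum_congr rfl fun d _ => ?_
        have : (fun p : ℝ × ℝ => ((MvPolynomial.coeff d f : ℤ) : ℝ) * (p.1 ^ d 0 * p.2 ^ d 1 * z ^ d 2)) =
            fun p : ℝ × ℝ => ((MvPolynomial.coeff d f : ℤ) : ℝ) * z ^ d 2 * (p.1 ^ d 0 * p.2 ^ d 1) := by
          funext p; ring
        rw [this, integral_const_mul, setIntegral_unitSquare_pow_mul_pow]
        ring
      · have : (fun p : ℝ × ℝ => ((MvPolynomial.coeff d f : ℤ) : ℝ) * (p.1 ^ d 0 * p.2 ^ d 1 * z ^ d 2)) =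
            fun p : ℝ × ℝ => ((MvPolynomial.coeff d f : ℤ) : ℝ) * z ^ d 2 * (p.1 ^ d 0 * p.2 ^ d 1) := by
          funext p; ring
        rw [this]
        exact (integrableOn_unitSquare_pow_mul_pow _ _).const_mul _
    rw [hint, mul_sum, hT', map_sum]
    refine sum_congr rfl fun d hd => ?_
    have h0 : d 0 + 1 ≤ A := by
      have := MvPolynomial.monomial_le_degreeOf 0 hd
      omega
    have h1 : d 1 + 1 ≤ B := by
      have := MvPolynomial.monomial_le_degreeOf 1 hd
      omega
    have hdA : ((d 0 + 1 : ℕ) : ℤ) ∣ (Nat.lcmUpto A : ℤ) := DilogPade.natCast_dvd_lcmUpto (by omega) h0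
    have hdB : ((d 1 + 1 : ℕ) : ℤ) ∣ (Nat.lcmUpto B : ℤ) := DilogPade.natCast_dvd_lcmUpto (by omega) h1
    have ha0 : ((d 0 : ℝ) + 1) ≠ 0 := by positivity
    have hb0 : ((d 1 : ℝ) + 1) ≠ 0 := by positivity
    simp only [map_mul, map_pow, Polynomial.aeval_X, eq_intCast, map_intCast]
    rw [Int.cast_div (by exact_mod_cast hdA) (by push_cast; exact ha0),
      Int.cast_div (by exact_mod_cast hdB) (by push_cast; exact hb0)]
    push_cast
    field_simp
  exact ⟨T', hdeg, hval⟩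

/-- `deg_z S ≤ e` for the Rhin–Viola polynomial `S = X₀^j(1−X₀)^h X₁^k(1−X₁)^l (X₀(1−X₁)+X₁X₂)^e`.
[cite: RhinViola2005, Lemma 2.2] -/
theorem degreeOf_two_rvPoly_le (h j k l e : ℕ) :
    (MvPolynomial.X 0 ^ j * (1 - MvPolynomial.X 0) ^ h * MvPolynomial.X 1 ^ k * (1 - MvPolynomial.X 1) ^ l *
        (MvPolynomial.X 0 * (1 - MvPolynomial.X 1) + MvPolynomial.X 1 * MvPolynomial.X 2) ^ e :
          MvPolynomial (Fin 3) ℤ).degreeOf 2 ≤ e := by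
  have hX : ∀ n : Fin 3, (MvPolynomial.X n : MvPolynomial (Fin 3) ℤ).degreeOf 2 = if (2 : Fin 3) = n then 1 else 0 :=
    fun n => MvPolynomial.degreeOf_X 2 n
  have h0 : (MvPolynomial.X 0 : MvPolynomial (Fin 3) ℤ).degreeOf 2 = 0 := by rw [hX]; decide
  have h1 : (MvPolynomial.X 1 : MvPolynomial (Fin 3) ℤ).degreeOf 2 = 0 := by rw [hX]; decide
  have h2 : (MvPolynomial.X 2 : MvPolynomial (Fin 3) ℤ).degreeOf 2 = 1 := by rw [hX]; decide
  have a1 : ((1 : MvPolynomial (Fin 3) ℤ) - MvPolynomial.X 0).degreeOf 2 = 0 := by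
    have := MvPolynomial.degreeOf_sub_le 2 (1 : MvPolynomial (Fin 3) ℤ) (MvPolynomial.X 0)
    rw [MvPolynomial.degreeOf_one, h0] at this
    simpa using this
  have a2 : ((1 : MvPolynomial (Fin 3) ℤ) - MvPolynomial.X 1).degreeOf 2 = 0 := by
    have := MvPolynomial.degreeOf_sub_le 2 (1 : MvPolynomial (Fin 3) ℤ) (MvPolynomial.X 1)
    rw [MvPolynomial.degreeOf_one, h1] at this
    simpa using this
  have a3 : (MvPolynomial.X 0 * (1 - MvPolynomial.X 1) + MvPolynomial.X 1 * MvPolynomial.X 2 :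
      MvPolynomial (Fin 3) ℤ).degreeOf 2 ≤ 1 := by
    refine (MvPolynomial.degreeOf_add_le _ _ _).trans (max_le ?_ ?_)
    · have := MvPolynomial.degreeOf_mul_le 2 (MvPolynomial.X 0 : MvPolynomial (Fin 3) ℤ) (1 - MvPolynomial.X 1)
      rw [h0, a2] at this
      omega
    · have := MvPolynomial.degreeOf_mul_le 2 (MvPolynomial.X 1 : MvPolynomial (Fin 3) ℤ) (MvPolynomial.X 2)
      rw [h1, h2] at this
      omega
  have e1 := (MvPolynomial.degreeOf_pow_le 2 (MvPolynomial.X 0 : MvPolynomial (Fin 3) ℤ) j)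
  have e2 := (MvPolynomial.degreeOf_pow_le 2 ((1 : MvPolynomial (Fin 3) ℤ) - MvPolynomial.X 0) h)
  have e3 := (MvPolynomial.degreeOf_pow_le 2 (MvPolynomial.X 1 : MvPolynomial (Fin 3) ℤ) k)
  have e4 := (MvPolynomial.degreeOf_pow_le 2 ((1 : MvPolynomial (Fin 3) ℤ) - MvPolynomial.X 1) l)
  have e5 := (MvPolynomial.degreeOf_pow_le 2
    (MvPolynomial.X 0 * (1 - MvPolynomial.X 1) + MvPolynomial.X 1 * MvPolynomial.X 2 : MvPolynomial (Fin 3) ℤ) e)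
  rw [h0] at e1
  rw [a1] at e2
  rw [h1] at e3
  rw [a2] at e4
  have m1 := MvPolynomial.degreeOf_mul_le 2 (MvPolynomial.X 0 ^ j : MvPolynomial (Fin 3) ℤ)
    ((1 - MvPolynomial.X 0) ^ h)
  have m2 := MvPolynomial.degreeOf_mul_le 2 (MvPolynomial.X 0 ^ j * (1 - MvPolynomial.X 0) ^ h :
    MvPolynomial (Fin 3) ℤ) (MvPolynomial.X 1 ^ k)
  have m3 := MvPolynomial.degreeOf_mul_le 2
    (MvPolynomial.X 0 ^ j * (1 - MvPolynomial.X 0) ^ h * MvPolynomial.X 1 ^ k : MvPolynomial (Fin 3) ℤ)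
    ((1 - MvPolynomial.X 1) ^ l)
  have m4 := MvPolynomial.degreeOf_mul_le 2
    (MvPolynomial.X 0 ^ j * (1 - MvPolynomial.X 0) ^ h * MvPolynomial.X 1 ^ k * (1 - MvPolynomial.X 1) ^ l :
      MvPolynomial (Fin 3) ℤ)
    ((MvPolynomial.X 0 * (1 - MvPolynomial.X 1) + MvPolynomial.X 1 * MvPolynomial.X 2) ^ e)
  have e5' : ((MvPolynomial.X 0 * (1 - MvPolynomial.X 1) + MvPolynomial.X 1 * MvPolynomial.X 2 :
      MvPolynomial (Fin 3) ℤ) ^ e).degreeOf 2 ≤ e := e5.trans (by simpa using Nat.mul_le_mul_left e a3)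
  simp only [mul_zero] at e1 e2 e3 e4
  omega

/-- **Rhin–Viola 2005, Lemma 2.2 for `I_z^{(0)}` with the degree bound**: if `j + k < m` there is `T ∈ ℤ[z]`
with `deg T ≤ m − j − k − 1` and `d_{m+h−k} d_{l+m−j} z^{l+m} I_z^{(0)}(h,j,k,l,m) = T(z)` for all real `z ≥ 1`.
[cite: RhinViola2005, Lemma 2.2] -/
theorem exists_poly_eq_lcm_mul_zpow_mul_I0_of_lt' {h j k l m : ℕ} (hm : j + k < m) :
    ∃ T : Polynomial ℤ, T.natDegree ≤ m - j - k - 1 ∧ ∀ z : ℝ, 1 ≤ z → (Polynomial.aeval z T : ℝ) =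
      (Nat.lcmUpto (m + h - k) : ℝ) * Nat.lcmUpto (l + m - j) * (z ^ ((l : ℤ) + m) * I0 z h j k l m) := by
  set e := m - (j + k + 1) with he
  obtain ⟨hdx, hdy⟩ := degreeOf_rvPoly_le h j k l e
  obtain ⟨T, hTdeg, hT⟩ := exists_poly_eq_lcm_mul_setIntegral_aeval'
    (MvPolynomial.X 0 ^ j * (1 - MvPolynomial.X 0) ^ h * MvPolynomial.X 1 ^ k * (1 - MvPolynomial.X 1) ^ l *
        (MvPolynomial.X 0 * (1 - MvPolynomial.X 1) + MvPolynomial.X 1 * MvPolynomial.X 2) ^ e :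
          MvPolynomial (Fin 3) ℤ) (A := m + h - k) (B := l + m - j) (by omega) (by omega)
  refine ⟨T, hTdeg.trans ((degreeOf_two_rvPoly_le h j k l e).trans (by omega)), fun z hz => ?_⟩
  rw [hT z, zpow_mul_I0_of_lt hz hm]
  congr 1
  refine setIntegral_congr_fun measurableSet_unitSquare fun p _ => ?_
  rw [aeval_rvPoly, denom₁]

end RhinViola

end Literature.NumberTheory.DiophantineApproximation

end
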